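import Summits.Ventures.PercRepro2.CaseOneStarCertT1
import Summits.Ventures.PercRepro2.CaseOneGadgetUWA1OBlockII0
import Summits.Ventures.PercRepro2.CaseOneGadgetUWA1OBlockII1
import Summits.Ventures.PercRepro2.CaseOneGadgetUWA1OBlockII2
import Summits.Ventures.PercRepro2.CaseOneGadgetUWA1OBlockII3
import Summits.Ventures.PercRepro2.CaseOneGadgetUWA1OBlockII4
import Summits.Ventures.PercRepro2.CaseOneGadgetUWA1OBlockII5
import Summits.Ventures.PercRepro2.CaseOneGadgetUWA1OBlockII6
import Summits.Ventures.PercRepro2.CaseOneGadgetUWA1OBlockII7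
import Summits.Ventures.PercRepro2.CaseOneGadgetUWA1OBlockII8
import Summits.Ventures.PercRepro2.CaseOneGadgetUWA1OBlockII9
import Summits.Ventures.PercRepro2.CaseOneGadgetUWA1OBlockII10
import Summits.Ventures.PercRepro2.CaseOneGadgetUWA1OBlockII11
import Summits.Ventures.PercRepro2.CaseOneGadgetUWA1OBlockII12
import Summits.Ventures.PercRepro2.CaseOneGadgetUWA1OBlockII13
import Summits.Ventures.PercRepro2.CaseOneGadgetUWA1OBlockII14

/-!
# The gadget `u ~ {w, a₁, o}`, `w ~ {u, a₂, b}` (uwa1o): the cell certificates of `iiAO5` (part 33b)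
(blind cell PercRepro2, p1 g34; the fourth gadget anchor of the six-form calculus — all six forms of the uwa1o gadget
as plain SFacts-cone certificate chains, generated by mining/p1/g34/uwa1o/genu.py = p1 g33's gent_uwa1.py / g25's
geno.py re-targeted; P1-G33 §6–§6″, P1-G34)

Each `eBAOII ijk kl` is a nonnegative combination of `(pairwise atom) × (cell)` and cubic cell monomials — or, for the degree-4 ones, `M × eBAOII ijk kl` (`M = Σ cᵢ` the total cell mass) is a nonnegative combination of `(atom) × (cell) × (cell)` and quartic cell monomials, then `SFacts.nonneg_of_sum_mul` (`CaseOneStarCertT1`) — exact LP certificates (kit j318477, every certificate re-verified exactly; data/p1/g33/gcerts_ii_uwa1o.json, form `ii`), here as exact `linear_combination`s over `SFacts` (the rational coefficients cleared by their common denominator). -/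

namespace Summit.Ventures.PercRepro2

namespace CaseOne

section CertAOII33b
variable {R : Type*} [Field R] [LinearOrder R] [IsStrictOrderedRing R]

set_option maxHeartbeats 0 in
/-- `eBAOII22313 ≥ 0`: the combination is identically zero (`ring`). -/
lemma eBAOII22313_nonneg (m : SCells R) (_hf : SFacts m) : 0 ≤ eBAOII22313 m := by
  have h : eBAOII22313 m = 0 := by
    unfold eBAOII22313 cBAOII00113 cBAOII00213 cBAOII01013 cBAOII01113 cBAOII01213 cBAOII01313 cBAOII02013 cBAOII02113 cBAOII02213 cBAOII02313 cBAOII10013 cBAOII10113 cBAOII10213 cBAOII10313 cBAOII11013 cBAOII11113 cBAOII11213 cBAOII11313 cBAOII12013 cBAOII12113 cBAOII12213 cBAOII12313 cBAOII20013 cBAOII20113 cBAOII20213 cBAOII20313 cBAOII21013 cBAOII21113 cBAOII21213 cBAOII21313 cBAOII22013 cBAOII22113 cBAOII22213 cBAOII22313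
    ring
  linarith [h]

set_option maxHeartbeats 0 in
/-- `eBAOII22320 ≥ 0`: the combination is identically zero (`ring`). -/
lemma eBAOII22320_nonneg (m : SCells R) (_hf : SFacts m) : 0 ≤ eBAOII22320 m := by
  have h : eBAOII22320 m = 0 := by
    unfold eBAOII22320 cBAOII00120 cBAOII00220 cBAOII01020 cBAOII01120 cBAOII01220 cBAOII01320 cBAOII02020 cBAOII02120 cBAOII02220 cBAOII02320 cBAOII10120 cBAOII10220 cBAOII10320 cBAOII11020 cBAOII11120 cBAOII11220 cBAOII11320 cBAOII12020 cBAOII12120 cBAOII12220 cBAOII12320 cBAOII20120 cBAOII20220 cBAOII20320 cBAOII21020 cBAOII21120 cBAOII21220 cBAOII21320 cBAOII22020 cBAOII22120 cBAOII22220 cBAOII22320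
    ring
  linarith [h]

end CertAOII33b

end CaseOne

end Summit.Ventures.PercRepro2
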